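import Summits.Ventures.HSemireg.WedgeHankelSubstitutionJordanPartition

/-!
# Venture HSemireg — THE KERNEL FLAG OF THE SHEAR ON TH-7's CLASSES IS THE OSCULATING FLAG OF THE POINT CLASS: `ker (SbC(shear λ) − 1)^k = span{E_{n+1−k}, …, E_n}` when
# `n!·λ ≠ 0` (characteristic `0` or `p > n`), with `dim = min(k, n+1)`, and dually `range (SbC(shear λ) − 1)^k = span{E_k, …, E_n}`; in every characteristic the top `k`
# spikes lie in `ker N^k` and `range N^k` lies in the span of `E_k, …, E_n`

HONEST FRAMING. Part of the Lean index of the computation cell `pub-hsemireg` (seat p10 gen 21, Sunday typer «UNIFORM-IN-n»).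
Finite-dimensional EXTERIOR ALGEBRA + linear algebra ONLY: no variety, no cohomology theory, no sheaf, no Ext group, no semiregularity map;
nothing here says that HC / HC_CM / HC_AV holds; no Literature fact is declared or used.  Custodian versions as in `WedgeHankelSiegelIdeal` (1/3) and `WedgeHankelFrameChange`;
the dictionary (`E_{n−j}` = the classes of forms vanishing to order `≥ n − j` at `∞`; the translation `ν ↦ ν + λ` preserves the order filtration at `∞` and is unipotent on its
graded pieces) is QUOTED, never asserted.

WHAT IS IN THE TREE.  K1 (`WedgeHankelSubstitutionJordanPartition`, this seat): `repr_SbC_shear_sub_one_pow_spikeBasis` (leading term `(i+1)⋯(i+k)·λ^k·E_{i+k}`),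
`SbC_shear_sub_one_pow_spikeBasis_eq_zero` (`i + k > n ⇒ N^k E_i = 0`), `card_le_finrank_range_SbC_shear_sub_one_pow` (`rank N^k ≥ #{i : i+k ≤ n, (i+1)⋯(i+k) ≠ 0}`);
I18: one Jordan block when `n!·λ^n ≠ 0`; J4 `finrank_ker_SbC_shear_sub_one_charZero` (`k = 1`: the kernel is the line of `E_n`).  THIS FILE (namespace
`Summit.Ventures.HSemireg.Wedge.HankelFrameChange` continued; imports K1) identifies the whole kernel flag:
* §281 EVERY CHARACTERISTIC: `spikeBasis_mem_ker_SbC_shear_sub_one_pow` (`n < i + k ⇒ E_i ∈ ker N^k`), **`span_spikeBasis_le_ker_SbC_shear_sub_one_pow`** (the span of the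
  top spikes `E_i`, `i + k > n`, lies in `ker N^k`), `finrank_span_top_spikes_ge`, **`min_le_finrank_ker_SbC_shear_sub_one_pow`** (`min(k, n+1) ≤ dim ker N^k`, every `λ`).
* §282 `n!·λ ≠ 0`: `ascFactorial_cast_ne_zero_of_factorial` (`(i+1)⋯(i+k) ∣ n!`), **`sub_le_finrank_range_SbC_shear_sub_one_pow_of_factorial`** (`rank N^k ≥ n + 1 − k`),
  **`finrank_ker_SbC_shear_sub_one_pow_of_factorial`: `dim ker (SbC(shear λ) − 1)^k = min(k, n+1)`**, and **`ker_SbC_shear_sub_one_pow_eq_span_of_factorial`: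
  `ker (SbC(shear λ) − 1)^k = span{E_i : n < i + k}`** — THE KERNEL FLAG IS THE FLAG OF TOP SPIKES (the osculating flag of the point class `E_n`); characteristic-`0`
  readings `finrank_ker_SbC_shear_sub_one_pow_charZero`, `ker_SbC_shear_sub_one_pow_eq_span_charZero`; `min_lt_finrank_ker_SbC_shear_sub_one_pow_char` (for `p ≤ n` the
  top spikes do NOT span the kernel).
* §287 THE IMAGE FLAG: **`range_SbC_shear_sub_one_pow_le_span`** (every characteristic: `range N^k ≤ span{E_a : a ≥ k}`), `finrank_span_spikes_ge_le`,
  **`range_SbC_shear_sub_one_pow_eq_span_of_factorial`** (`n!·λ ≠ 0`: `range N^k = span{E_k, …, E_n}`), `range_SbC_shear_sub_one_pow_eq_span_charZero`.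
NOT typed here: the kernel / image flags in characteristic `p ≤ n` (NOT spanned by spikes in general: `p = 2`, `n = 3`, `ker N ∋ E_1 − λE_2`); anything Ext-side.
New names only.
-/

open Module

namespace Summit.Ventures.HSemireg.Wedge.HankelFrameChange

open Summit.Ventures.HSemireg.Wedge Summit.Ventures.HSemireg.Wedge.Kunneth Summit.Ventures.HSemireg.Wedge.Hankel
  Summit.Ventures.HSemireg.Wedge.BasisFree Summit.Ventures.HSemireg.Wedge.HankelSiegel Summit.Ventures.HSemireg.Wedge.HankelSiegelIdeal
  Summit.Ventures.HSemireg.Wedge.KunnethKernel Summit.Ventures.HSemireg.Wedge.HankelRankOne Summit.Ventures.HSemireg.Wedge.KernelDuality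

variable (K : Type*) [Field K] {n : ℕ}

/-! ## §281. Every characteristic: the top `k` spikes lie in `ker (SbC(shear λ) − 1)^k` -/

/-- `n < i + k ⇒ E_i ∈ ker (SbC(shear λ) − 1)^k` (K1: the leading term would sit beyond `E_n`). -/
theorem spikeBasis_mem_ker_SbC_shear_sub_one_pow (lam : K) {i : Fin (n + 1)} {k : ℕ} (h : n < (i : ℕ) + k) :
    spikeBasis K n i ∈ LinearMap.ker ((SbC K 1 lam 0 1 - 1) ^ k) :=
  LinearMap.mem_ker.mpr (SbC_shear_sub_one_pow_spikeBasis_eq_zero K lam h)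

/-- **the span of the top spikes `E_i`, `i + k > n`, lies in `ker (SbC(shear λ) − 1)^k`** (every field, every `λ`). -/
theorem span_spikeBasis_le_ker_SbC_shear_sub_one_pow (lam : K) (k : ℕ) :
    Submodule.span K (Set.range fun i : {i : Fin (n + 1) // n < (i : ℕ) + k} => spikeBasis K n i) ≤ LinearMap.ker ((SbC K 1 lam 0 1 - 1) ^ k) := by
  rw [Submodule.span_le]
  rintro _ ⟨i, rfl⟩
  exact spikeBasis_mem_ker_SbC_shear_sub_one_pow K lam i.2

/-- the top spikes are independent, so their span has dimension `#{i ≤ n : n < i + k} ≥ min(k, n+1)`. -/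
theorem finrank_span_top_spikes_ge (k : ℕ) :
    min k (n + 1) ≤ finrank K ↥(Submodule.span K (Set.range fun i : {i : Fin (n + 1) // n < (i : ℕ) + k} => spikeBasis K n i)) := by
  classical
  have hli : LinearIndependent K fun i : {i : Fin (n + 1) // n < (i : ℕ) + k} => spikeBasis K n i :=
    (spikeBasis K n).linearIndependent.comp (fun i : {i : Fin (n + 1) // n < (i : ℕ) + k} => (i : Fin (n + 1))) Subtype.val_injective
  rw [finrank_span_eq_card hli]
  let ι : Fin (min k (n + 1)) → {i : Fin (n + 1) // n < (i : ℕ) + k} := fun j =>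
    ⟨⟨n - (j : ℕ), by omega⟩, by have := j.2; have := min_le_left k (n + 1); simp only; omega⟩
  have hι : Function.Injective ι := fun j j' e => by
    have e' := congrArg (fun x => ((x.1 : Fin (n + 1)) : ℕ)) e
    have h1 := j.2; have h2 := j'.2; have := min_le_right k (n + 1)
    simp only [ι] at e'
    exact Fin.ext (by omega)
  have h := Fintype.card_le_of_injective ι hι
  rwa [Fintype.card_fin] at h

/-- **`min(k, n+1) ≤ dim ker (SbC(shear λ) − 1)^k`** on th-7's classes, every field, every `λ`. -/
theorem min_le_finrank_ker_SbC_shear_sub_one_pow (lam : K) (k : ℕ) : min k (n + 1) ≤ finrank K ↥(LinearMap.ker ((SbC K 1 lam 0 1 (n := n) - 1) ^ k)) :=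
  (finrank_span_top_spikes_ge K k).trans (Submodule.finrank_mono (span_spikeBasis_le_ker_SbC_shear_sub_one_pow K lam k))

/-! ## §282. `n!·λ ≠ 0`: the kernel flag is the flag of top spikes -/

omit [Field K] in
/-- `n! ≠ 0` in `K` and `i + k ≤ n ⇒ (i+1)(i+2)⋯(i+k) ≠ 0` in `K` (it divides `(i+k)! ∣ n!`). -/
theorem ascFactorial_cast_ne_zero_of_factorial (K : Type*) [CommRing K] (hfac : (n.factorial : K) ≠ 0) {i k : ℕ} (h : i + k ≤ n) :
    (((i + 1).ascFactorial k : ℕ) : K) ≠ 0 := by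
  intro h0
  obtain ⟨c, hc⟩ : (i + 1).ascFactorial k ∣ n.factorial :=
    (Dvd.intro_left _ (Nat.factorial_mul_ascFactorial i k)).trans (Nat.factorial_dvd_factorial h)
  exact hfac (by rw [hc, Nat.cast_mul, h0, zero_mul])

open Classical in
/-- **`n!·λ ≠ 0 ⇒ rank (SbC(shear λ) − 1)^k ≥ n + 1 − k`** (K1's independent images `N^k E_i`, `i + k ≤ n`, all available). -/
theorem sub_le_finrank_range_SbC_shear_sub_one_pow_of_factorial (hfac : (n.factorial : K) ≠ 0) {lam : K} (hlam : lam ≠ 0) (k : ℕ) :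
    n + 1 - k ≤ finrank K ↥(LinearMap.range ((SbC K 1 lam 0 1 (n := n) - 1) ^ k)) := by
  refine le_trans ?_ (card_le_finrank_range_SbC_shear_sub_one_pow K hlam k)
  let ι : Fin (n + 1 - k) → {i : Fin (n + 1) // (i : ℕ) + k ≤ n ∧ ((((i : ℕ) + 1).ascFactorial k : ℕ) : K) ≠ 0} := fun j =>
    ⟨⟨(j : ℕ), by omega⟩, ⟨show (j : ℕ) + k ≤ n by omega, ascFactorial_cast_ne_zero_of_factorial K hfac (i := (j : ℕ)) (k := k) (by have := j.2; omega)⟩⟩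
  have hι : Function.Injective ι := fun j j' e => Fin.ext (by simpa [ι] using congrArg (fun x => ((x.1 : Fin (n + 1)) : ℕ)) e)
  have h := Fintype.card_le_of_injective ι hι
  rwa [Fintype.card_fin] at h

/-- **`n!·λ ≠ 0 ⇒ dim ker (SbC(shear λ) − 1)^k = min(k, n+1)`** (one Jordan block, I18, with all kernel dimensions). -/
theorem finrank_ker_SbC_shear_sub_one_pow_of_factorial (hfac : (n.factorial : K) ≠ 0) {lam : K} (hlam : lam ≠ 0) (k : ℕ) :
    finrank K ↥(LinearMap.ker ((SbC K 1 lam 0 1 (n := n) - 1) ^ k)) = min k (n + 1) := by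
  refine le_antisymm ?_ (min_le_finrank_ker_SbC_shear_sub_one_pow K lam k)
  rcases le_or_gt k (n + 1) with hk | hk
  · have h1 := LinearMap.finrank_range_add_finrank_ker ((SbC K 1 lam 0 1 (n := n) - 1) ^ k)
    have h2 := sub_le_finrank_range_SbC_shear_sub_one_pow_of_factorial K hfac hlam k (n := n)
    rw [finrank_eq_card_basis (spikeBasis K n), Fintype.card_fin] at h1
    rw [min_eq_left hk]
    omega
  · rw [min_eq_right hk.le, pow_eq_zero_of_le hk.le (SbC_shear_sub_one_pow_succ K lam), LinearMap.ker_zero, finrank_top, finrank_eq_card_basis (spikeBasis K n),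
      Fintype.card_fin]

/-- **THE KERNEL FLAG IS THE FLAG OF TOP SPIKES: `n!·λ ≠ 0 ⇒ ker (SbC(shear λ) − 1)^k = span{E_i : n < i + k}`** (`= span{E_{n+1−k}, …, E_n}`; characteristic `0` or `p > n`). -/
theorem ker_SbC_shear_sub_one_pow_eq_span_of_factorial (hfac : (n.factorial : K) ≠ 0) {lam : K} (hlam : lam ≠ 0) (k : ℕ) :
    LinearMap.ker ((SbC K 1 lam 0 1 (n := n) - 1) ^ k) = Submodule.span K (Set.range fun i : {i : Fin (n + 1) // n < (i : ℕ) + k} => spikeBasis K n i) := by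
  refine (Submodule.eq_of_le_of_finrank_le (span_spikeBasis_le_ker_SbC_shear_sub_one_pow K lam k) ?_).symm
  rw [finrank_ker_SbC_shear_sub_one_pow_of_factorial K hfac hlam k]
  exact finrank_span_top_spikes_ge K k

/-- characteristic `0`: `dim ker (SbC(shear λ) − 1)^k = min(k, n+1)` for every `λ ≠ 0`. -/
theorem finrank_ker_SbC_shear_sub_one_pow_charZero [CharZero K] {lam : K} (hlam : lam ≠ 0) (k : ℕ) :
    finrank K ↥(LinearMap.ker ((SbC K 1 lam 0 1 (n := n) - 1) ^ k)) = min k (n + 1) :=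
  finrank_ker_SbC_shear_sub_one_pow_of_factorial K (Nat.cast_ne_zero.mpr (Nat.factorial_ne_zero n)) hlam k

/-- characteristic `0`: `ker (SbC(shear λ) − 1)^k = span{E_i : n < i + k}` for every `λ ≠ 0`. -/
theorem ker_SbC_shear_sub_one_pow_eq_span_charZero [CharZero K] {lam : K} (hlam : lam ≠ 0) (k : ℕ) :
    LinearMap.ker ((SbC K 1 lam 0 1 (n := n) - 1) ^ k) = Submodule.span K (Set.range fun i : {i : Fin (n + 1) // n < (i : ℕ) + k} => spikeBasis K n i) :=
  ker_SbC_shear_sub_one_pow_eq_span_of_factorial K (Nat.cast_ne_zero.mpr (Nat.factorial_ne_zero n)) hlam k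

/-- **in characteristic `p`, for `k ≤ p` and `k ≤ n % p + 1` the kernel of `N^k` is STILL the span of the top spikes whenever it has dimension `k`** — i.e. when `⌊n/p⌋ = 0`
(`n < p`, the factorial case); in general `dim ker N^k = ⌊n/p⌋·min(k,p) + min(k, n%p+1) > min(k, n+1)` as soon as `p ≤ n` and `1 ≤ k ≤ n` (K1), so the top spikes do NOT
span the kernel: recorded as the inequality `min(k, n+1) < dim ker N^k` for `p ≤ n`, `1 ≤ k ≤ n`, `λ ≠ 0`. -/
theorem min_lt_finrank_ker_SbC_shear_sub_one_pow_char {lam : K} (hlam : lam ≠ 0) (p : ℕ) [Fact p.Prime] [CharP K p] (hpn : p ≤ n) {k : ℕ} (hk1 : 1 ≤ k)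
    (hkn : k ≤ n) : min k (n + 1) < finrank K ↥(LinearMap.ker ((SbC K 1 lam 0 1 (n := n) - 1) ^ k)) := by
  have hp : p.Prime := Fact.out
  rw [finrank_ker_SbC_shear_sub_one_pow_char K hlam p k, min_eq_left (by omega : k ≤ n + 1)]
  have hq : 1 ≤ n / p := (Nat.le_div_iff_mul_le hp.pos).mpr (by rw [one_mul]; exact hpn)
  have hmod := Nat.mod_lt n hp.pos
  rcases le_or_gt k p with hkp | hkp
  · rw [min_eq_left hkp]
    have : k ≤ n / p * k := Nat.le_mul_of_pos_left k hq
    rcases le_or_gt k (n % p + 1) with hks | hks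
    · rw [min_eq_left hks]; omega
    · rw [min_eq_right hks.le]; omega
  · rw [min_eq_right hkp.le, min_eq_right (by omega : n % p + 1 ≤ k)]
    -- `k > p`: `(n/p)·p + n%p + 1 = n + 1 > k`... here `k ≤ n` so `n/p * p + (n%p+1) = n+1 > k`
    have := Nat.div_add_mod' n p
    omega

/-! ## §287. The image flag: `range (SbC(shear λ) − 1)^k ⊆ span{E_k, …, E_n}`, with equality when `n!·λ ≠ 0` -/

/-- **every characteristic: `range (SbC(shear λ) − 1)^k ≤ span{E_a : k ≤ a}`** (the images `N^k E_i` have no spike coordinate below `i + k ≥ k`, K1). -/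
theorem range_SbC_shear_sub_one_pow_le_span (lam : K) (k : ℕ) :
    LinearMap.range ((SbC K 1 lam 0 1 (n := n) - 1) ^ k) ≤ Submodule.span K (Set.range fun a : {a : Fin (n + 1) // k ≤ (a : ℕ)} => spikeBasis K n a) := by
  classical
  rw [LinearMap.range_eq_map, ← (spikeBasis K n).span_eq, Submodule.map_span, Submodule.span_le]
  rintro _ ⟨_, ⟨i, rfl⟩, rfl⟩
  -- `N^k E_i = Σ_a c_a E_a` with `c_a = 0` for `a < i + k`, in particular for `a < k`
  rw [← (spikeBasis K n).sum_repr (((SbC K 1 lam 0 1 - 1) ^ k) (spikeBasis K n i))]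
  refine Submodule.sum_mem _ fun a _ => ?_
  by_cases ha : k ≤ (a : ℕ)
  · exact Submodule.smul_mem _ _ (Submodule.subset_span ⟨⟨a, ha⟩, rfl⟩)
  · rw [(repr_SbC_shear_sub_one_pow_spikeBasis K lam i k).1 a (by omega), zero_smul]
    exact Submodule.zero_mem _

/-- the span of the spikes `E_a`, `a ≥ k`, has dimension `≤ n + 1 − k`. -/
theorem finrank_span_spikes_ge_le (k : ℕ) :
    finrank K ↥(Submodule.span K (Set.range fun a : {a : Fin (n + 1) // k ≤ (a : ℕ)} => spikeBasis K n a)) ≤ n + 1 - k := by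
  classical
  refine (finrank_range_le_card _).trans ?_
  let ι : {a : Fin (n + 1) // k ≤ (a : ℕ)} → Fin (n + 1 - k) := fun a => ⟨(a : ℕ) - k, by have := a.1.2; have := a.2; omega⟩
  have hι : Function.Injective ι := fun a a' e => by
    have e' := congrArg Fin.val e
    have h1 := a.2; have h2 := a'.2
    simp only [ι] at e'
    exact Subtype.ext (Fin.ext (by omega))
  have h := Fintype.card_le_of_injective ι hι
  rwa [Fintype.card_fin] at h

/-- **THE IMAGE FLAG: `n!·λ ≠ 0 ⇒ range (SbC(shear λ) − 1)^k = span{E_k, …, E_n}`** (containment in every characteristic, §287; the rank `n + 1 − k`, §282). -/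
theorem range_SbC_shear_sub_one_pow_eq_span_of_factorial (hfac : (n.factorial : K) ≠ 0) {lam : K} (hlam : lam ≠ 0) (k : ℕ) :
    LinearMap.range ((SbC K 1 lam 0 1 (n := n) - 1) ^ k) = Submodule.span K (Set.range fun a : {a : Fin (n + 1) // k ≤ (a : ℕ)} => spikeBasis K n a) :=
  Submodule.eq_of_le_of_finrank_le (range_SbC_shear_sub_one_pow_le_span K lam k)
    ((finrank_span_spikes_ge_le K k).trans (sub_le_finrank_range_SbC_shear_sub_one_pow_of_factorial K hfac hlam k))

/-- characteristic `0`: `range (SbC(shear λ) − 1)^k = span{E_k, …, E_n}` for every `λ ≠ 0` — together with §282: `ker N^k = range N^{n+1−k}` is the flag of top spikes read from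
both ends. -/
theorem range_SbC_shear_sub_one_pow_eq_span_charZero [CharZero K] {lam : K} (hlam : lam ≠ 0) (k : ℕ) :
    LinearMap.range ((SbC K 1 lam 0 1 (n := n) - 1) ^ k) = Submodule.span K (Set.range fun a : {a : Fin (n + 1) // k ≤ (a : ℕ)} => spikeBasis K n a) :=
  range_SbC_shear_sub_one_pow_eq_span_of_factorial K (Nat.cast_ne_zero.mpr (Nat.factorial_ne_zero n)) hlam k

end Summit.Ventures.HSemireg.Wedge.HankelFrameChange
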